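import Summits.BirchSwinnertonDyer.BirchSwinnertonDyer.Theorems.ManinLocalTwoThreePinningFourHundredTablesC
import HarnessLib

/-!
# Level 400 by the PINNING KERNEL — table certificates (part 4 of 11)

Cell `bsd-f2-manin`, route `ManinLocalTwoThree`, crux C2 `ManinOddAtFour` (stmt-BirchSwinnertonDyer-22967), an g57 (pipeline of an g56);
`--supports stmt-BirchSwinnertonDyer-22967` (helper).  The convolution certificates `tabsᵢ · DEN(rᵢ) = NUM(rᵢ, aᵢ)` (depth 192,
SPARSE certificates of an g55 `…EtaCertificateSparse` (trivial products skipped, pentagonal Euler tables of p3 `…EtaCertificateFast`), one `decide +kernel` each) of forms `25 … 31` of `…PinningFourHundredTables`.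
HONEST FRAMING: kernel-checked identities of integer lists only. [cite: Koehler2011, §2.1]
-/

set_option autoImplicit false
-- lint-debt: the directory name repeats the summit name (sibling precedent `ManinLocalTwoThreePinningSixtyThree.lean`)
set_option linter.dupNamespace false

noncomputable section


open Complex
open UpperHalfPlane hiding I
open scoped MatrixGroups ModularForm
open ModularForm CongruenceSubgroup
open Literature.NumberTheory.ModularForms
open Literature.NumberTheory.EllipticCurves Literature.NumberTheory.EllipticCurves.ModularForms

namespace Summit.BirchSwinnertonDyer.BirchSwinnertonDyer.Theorems.ManinLocalTwoThree.PinningFourHundred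

open Summit.BirchSwinnertonDyer.BirchSwinnertonDyer.Theorems.ManinLocalTwoThree.BracketSturm
open Summit.BirchSwinnertonDyer.BirchSwinnertonDyer.Theorems.ManinLocalTwoThree.PinningKernel


set_option maxHeartbeats 4000000
set_option maxRecDepth 16384

/-! ## §2d Table certificates (forms `25 … 31`) -/

/-- Table certificate of the basis quotient `25` (kernel `decide`). [folklore] -/
theorem hcert25 : mulList 192 (tabs 25) (etaDenListSparse 192 400 (expFn (Ls[25]).1)) = etaNumListSparse 192 400 (expFn (Ls[25]).1) (shifts 25) := by decide +kernel
/-- Table certificate of the basis quotient `26` (kernel `decide`). [folklore] -/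
theorem hcert26 : mulList 192 (tabs 26) (etaDenListSparse 192 400 (expFn (Ls[26]).1)) = etaNumListSparse 192 400 (expFn (Ls[26]).1) (shifts 26) := by decide +kernel
/-- Table certificate of the basis quotient `27` (kernel `decide`). [folklore] -/
theorem hcert27 : mulList 192 (tabs 27) (etaDenListSparse 192 400 (expFn (Ls[27]).1)) = etaNumListSparse 192 400 (expFn (Ls[27]).1) (shifts 27) := by decide +kernel
/-- Table certificate of the basis quotient `28` (kernel `decide`). [folklore] -/
theorem hcert28 : mulList 192 (tabs 28) (etaDenListSparse 192 400 (expFn (Ls[28]).1)) = etaNumListSparse 192 400 (expFn (Ls[28]).1) (shifts 28) := by decide +kernel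
/-- Table certificate of the basis quotient `29` (kernel `decide`). [folklore] -/
theorem hcert29 : mulList 192 (tabs 29) (etaDenListSparse 192 400 (expFn (Ls[29]).1)) = etaNumListSparse 192 400 (expFn (Ls[29]).1) (shifts 29) := by decide +kernel
/-- Table certificate of the basis quotient `30` (kernel `decide`). [folklore] -/
theorem hcert30 : mulList 192 (tabs 30) (etaDenListSparse 192 400 (expFn (Ls[30]).1)) = etaNumListSparse 192 400 (expFn (Ls[30]).1) (shifts 30) := by decide +kernel
/-- Table certificate of the basis quotient `31` (kernel `decide`). [folklore] -/
theorem hcert31 : mulList 192 (tabs 31) (etaDenListSparse 192 400 (expFn (Ls[31]).1)) = etaNumListSparse 192 400 (expFn (Ls[31]).1) (shifts 31) := by decide +kernel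

end Summit.BirchSwinnertonDyer.BirchSwinnertonDyer.Theorems.ManinLocalTwoThree.PinningFourHundred

end
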